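import Summits.BirchSwinnertonDyer.Rank1Residual.X12.InertBadLocalTypesThree
import HarnessLib

/-!
# The local type of the X12 corner at a CM-RAMIFIED `p ≥ 5` (class O11): Kodaira `III` or `III*`,
# `p ∈ {7, 11, 19, 43, 67, 163}`, `p ≡ 3 (mod 4)` — so `e = 4 ∣ p + 1` on O11 as well

HONEST FRAMING (cell `b2b-bsdres`, run/shared/lean/b2b/bsd-rank1-residual/, verbatim in every
file): the goal of the cell is to DELETE the COMBINATION-SHAPED residual classes of the
Birch–Swinnerton-Dyer formula for ALL analytic-rank `≤ 1` elliptic curves over `ℚ` — "full BSD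
formula for every rank `≤ 1` curve in class `C`" assembled STRICTLY from published theorems — so
that the rank-`≤ 1` remainder becomes exactly the CONSTRUCTION-SHAPED classes, which are TYPED
(missing-input `Prop`s), NOT attempted. This is not "finishing BSD". Unit `b2b-bsdres-x1b` (X12
prover owner), generation 24; research route, no claim beyond the stated class; X12 REMAINS
CONSTRUCTION-SHAPED; nothing is booked here — booking is the lane's and the referee's.

Theorems only; no definition, no new named fact. §1 is a Tate-algorithm engine (Steps 1–3 and 6–9 of
*ATAEC* IV.9.4 via the tree's `kodairaSymbolOfMinimal_eq_III_of_step2` / `_IIIstar_of_step9`) for the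
quadratic twists of a short model `E₀ : y² = x³ + Ax + B` at an odd place `v` over `ℓ` with
`ℓ ∥ A`, `ℓ² ∣ B`, `ℓ³ ∥ Δ(E₀)` (type `III` data): the twist `E₀^{(n)}` by `n` with `ℓ ∤ n` has type
`III`, by `n` with `ℓ ∥ n` type `III*` (`ord_v Δ = 3, 9 < 12`: minimal). §2 applies it to the X12
corner at a CM-RAMIFIED prime `p ≥ 5` (`p ∣ d_K`; class O11 of HOME `CLASS-CLOSURE-PLAN.md` §3.14):
`p ∣ d_K` with `p ≥ 5` forces `d_K ∈ {−7, −11, −19, −43, −67, −163}`, `p = |d_K| ≡ 3 (mod 4)`, and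
the curve is a quadratic twist of the short model of Cremona `49a1/49a2/121b1/361a1/1849a1/4489a1/
26569a1` (Gross's `A(p)`, type `III` at `p`), hence of type `III` or `III*` at the place over `p`:
`e = 4 ∣ p + 1`. With `InertBadLocalTypes(Three).lean` (inert `p ≥ 5`, `p = 3`) this completes the
local-type law `e ∣ p + 1` on the bad non-split CM core `p ≥ 3`. Census companion (evidence): HOME
`b2b-bsdres-x1b/gen23/e2/` (65 ramified pairs). Not claimed: `p ∈ {2, 3}`; anything about BSD.

References: [SilvermanATAEC1994] IV.9.4, Table 4.1, App. A §3; [SilvermanAEC2009] X.5.4, VII.1.1; [Cremona1997] Table 1; Gross, LNM 776 (1980) §§22–24 (`A(p)`).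
-/

noncomputable section

open scoped Classical NumberField

open WeierstrassCurve NumberField IsDedekindDomain IsDedekindDomain.HeightOneSpectrum Field
  Rat.HeightOneSpectrum Literature.NumberTheory.EllipticCurves
  Literature.NumberTheory.GaloisRepresentations
  Literature.NumberTheory.EllipticCurves.ModularForms
  Literature.NumberTheory.EllipticCurves.Rank1Residual
  Literature.NumberTheory.EllipticCurves.Rank1Residual.Typed
  Literature.NumberTheory.Automorphic
  Literature.NumberTheory.DiophantineGeometry
  Literature.NumberTheory.DiophantineGeometry.TateAlgorithm
  Summit.BirchSwinnertonDyer.Rank1Residual.X11b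

namespace Summit.BirchSwinnertonDyer.Rank1Residual.X12

/-- An element of `O_v` of valuation exactly `exp(-n)` is not divisible by `ϖⁿ⁺¹` (copy of gen 22's
private helper in `J1728TamagawaThree.lean`). [folklore] -/
private theorem not_pow_succ_dvd_of_valued_eq'' (v : HeightOneSpectrum (𝓞 ℚ))
    {x : v.adicCompletionIntegers ℚ} {n : ℕ}
    (h : Valued.v (x : v.adicCompletion ℚ) = WithZero.exp (-(n : ℤ))) :
    ¬ uniformizer (v.adicCompletionIntegers ℚ) ^ (n + 1) ∣ x := by
  have hϖ : Irreducible (uniformizer (v.adicCompletionIntegers ℚ)) := irreducible_uniformizer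
  obtain ⟨u, hu, hx⟩ := exists_isUnit_eq_uniformizer_pow_mul_of_valued_eq v h
  rintro ⟨c, hc⟩
  rw [hx, pow_succ, mul_assoc] at hc
  have hc' : u = uniformizer (v.adicCompletionIntegers ℚ) * c :=
    mul_left_cancel₀ (pow_ne_zero n hϖ.ne_zero) hc
  exact hϖ.not_isUnit (isUnit_of_mul_isUnit_left (hc' ▸ hu))

/-- A prime `p ≥ 5` dividing a prime `q` (as integers) IS `q`. [folklore] -/
private theorem eq_of_prime_dvd_prime {p q : ℕ} (hq : q.Prime) (hp5 : 5 ≤ p) (h : (p : ℤ) ∣ (q : ℤ)) :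
    p = q := by
  have h' : p ∣ q := by exact_mod_cast h
  rcases (Nat.dvd_prime hq).mp h' with h1 | h1
  · omega
  · exact h1

/-! ### §1 Tate's algorithm for the twists of a short model of type `III` -/

/-- **Twists of a type-`III` short model: `III` (unit twist) or `III*` (uniformiser twist).** Let
`E₀ : y² = x³ + Ax + B` with `A, B ∈ ℤ`, `v` a place over `ℓ` with `ℓ ∥ A`, `ℓ² ∣ B`,
`ℓ³ ∥ Δ(E₀)`, and `M = E₀^{(n)} = D • W` for an integer `n` with `ℓ² ∤ n`. Then `M = (y² = x³ +
n²A x + n³B)` is `v`-integral with `ord_v(a₄, a₆, b₈, Δ) = (2s+1, ≥ 3s+2, 4s+2, 6s+3)`, `s = ord_v n ∈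
{0, 1}`, hence minimal, and Tate's algorithm returns `III` (`s = 0`: Step 3, `π³ ∤ b₈`) or `III*`
(`s = 1`: Step 9, `π⁴ ∤ a₄`). [cite: SilvermanATAEC1994, IV.9.4 Steps 1–9 (PDF pp. 344–346) and Table 4.1]
[cite: SilvermanAEC2009, VII.1 Remark 1.1] -/
theorem kodairaSymbolAt_of_short_twist (W : WeierstrassCurve ℚ) [W.IsElliptic]
    (v : HeightOneSpectrum (𝓞 ℚ)) (A B Dz : ℤ)
    (hΔ : (⟨0, 0, 0, (A : ℚ), (B : ℚ)⟩ : WeierstrassCurve ℚ).Δ = Dz)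
    (hA1 : (natGenerator v : ℤ) ∣ A) (hA2 : ¬ (natGenerator v : ℤ) ^ 2 ∣ A)
    (hB2 : (natGenerator v : ℤ) ^ 2 ∣ B)
    (hD3 : (natGenerator v : ℤ) ^ 3 ∣ Dz) (hD4 : ¬ (natGenerator v : ℤ) ^ 4 ∣ Dz)
    {n : ℤ} (hn2 : ¬ (natGenerator v : ℤ) ^ 2 ∣ n) (D : VariableChange ℚ)
    (hM : (⟨0, 0, 0, (A : ℚ), (B : ℚ)⟩ : WeierstrassCurve ℚ).quadraticTwist (n : ℚ) = D • W) :
    W.kodairaSymbolAt v = .III ∨ W.kodairaSymbolAt v = .IIIstar := by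
  haveI := perfectField_residueField_adicCompletionIntegers (K := ℚ) v
  set E₀ : WeierstrassCurve ℚ := ⟨0, 0, 0, (A : ℚ), (B : ℚ)⟩ with hE₀
  set M := E₀.quadraticTwist (n : ℚ) with hMdef
  haveI hMell : M.IsElliptic := by rw [hM]; infer_instance
  set ℓ := natGenerator v with hℓdef
  have hℓp : ℓ.Prime := prime_natGenerator v
  have hℓv : v.valuation ℚ (ℓ : ℚ) = WithZero.exp (-1 : ℤ) := Rat.valuation_natGenerator v
  -- `s = ord_v n ∈ {0, 1}`
  obtain ⟨s, hs1, hnv⟩ : ∃ s : ℕ, s ≤ 1 ∧ v.valuation ℚ (n : ℚ) = WithZero.exp (-(s : ℤ)) := by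
    by_cases hℓn : (ℓ : ℤ) ∣ n
    · exact ⟨1, le_rfl, by exact_mod_cast valuation_ringOfIntegers_intCast_eq_exp_neg_one v hℓn hn2⟩
    · exact ⟨0, by omega, by rw [Rat.valuation_intCast_eq_one v hℓn]; norm_cast⟩
  -- valuations of `A`, `B`, `Dz`
  have hvA : v.valuation ℚ (A : ℚ) = WithZero.exp (-1 : ℤ) :=
    valuation_ringOfIntegers_intCast_eq_exp_neg_one v hA1 hA2
  have hvB : v.valuation ℚ (B : ℚ) ≤ WithZero.exp (-2 : ℤ) := by
    obtain ⟨B', hB'⟩ := hB2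
    rw [hB', Int.cast_mul, Int.cast_pow, Int.cast_natCast, map_mul, map_pow, hℓv,
      ← WithZero.exp_nsmul]
    calc WithZero.exp (2 • (-1 : ℤ)) * v.valuation ℚ (B' : ℚ)
        ≤ WithZero.exp (2 • (-1 : ℤ)) * 1 := by
          gcongr; exact valuation_ringOfIntegers_intCast_le_one v B'
      _ = WithZero.exp (-2 : ℤ) := by rw [mul_one]; norm_num
  have hvD : v.valuation ℚ (Dz : ℚ) = WithZero.exp (-3 : ℤ) := by
    obtain ⟨D', hD'⟩ := hD3
    have hnd : ¬ (ℓ : ℤ) ∣ D' := fun h ↦ hD4 (by rw [hD', pow_succ]; exact mul_dvd_mul_left _ h)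
    rw [hD', Int.cast_mul, Int.cast_pow, Int.cast_natCast, map_mul, map_pow, hℓv,
      Rat.valuation_intCast_eq_one v hnd, mul_one, ← WithZero.exp_nsmul]
    norm_num
  -- the coefficients of `M`
  have e₁ : M.a₁ = 0 := by rw [hMdef, quadraticTwist_a₁]
  have e₂ : M.a₂ = 0 := by rw [hMdef, quadraticTwist_a₂]; simp [hE₀, WeierstrassCurve.b₂]
  have e₃ : M.a₃ = 0 := by rw [hMdef, quadraticTwist_a₃]
  have e₄ : M.a₄ = (n : ℚ) ^ 2 * A := by
    rw [hMdef, quadraticTwist_a₄]; simp only [hE₀, WeierstrassCurve.b₄]; ring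
  have e₆ : M.a₆ = (n : ℚ) ^ 3 * B := by
    rw [hMdef, quadraticTwist_a₆]; simp only [hE₀, WeierstrassCurve.b₆]; ring
  have eb₂ : M.b₂ = 0 := by simp only [WeierstrassCurve.b₂, e₁, e₂]; ring
  have eb₈ : M.b₈ = -((n : ℚ) ^ 2 * A) ^ 2 := by
    simp only [WeierstrassCurve.b₈, e₁, e₂, e₃, e₄, e₆]; ring
  have eΔ : M.Δ = (n : ℚ) ^ 6 * Dz := by rw [hMdef, quadraticTwist_Δ, hΔ]
  -- valuations of the coefficients of `M`
  have hva₄ : v.valuation ℚ M.a₄ = WithZero.exp (-((2 * s + 1 : ℕ) : ℤ)) := by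
    rw [e₄, map_mul, map_pow, hnv, hvA, ← WithZero.exp_nsmul, ← WithZero.exp_add]
    congr 1; push_cast; ring
  have hva₆ : v.valuation ℚ M.a₆ ≤ WithZero.exp (-((3 * s + 2 : ℕ) : ℤ)) := by
    rw [e₆, map_mul, map_pow, hnv, ← WithZero.exp_nsmul]
    calc WithZero.exp (3 • -(s : ℤ)) * v.valuation ℚ (B : ℚ)
        ≤ WithZero.exp (3 • -(s : ℤ)) * WithZero.exp (-2 : ℤ) := by gcongr
      _ = WithZero.exp (-((3 * s + 2 : ℕ) : ℤ)) := by
          rw [← WithZero.exp_add]; congr 1; push_cast; ring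
  have hvb₈ : v.valuation ℚ M.b₈ = WithZero.exp (-((4 * s + 2 : ℕ) : ℤ)) := by
    rw [eb₈, Valuation.map_neg, map_pow, map_mul, map_pow, hnv, hvA, ← WithZero.exp_nsmul,
      ← WithZero.exp_add, ← WithZero.exp_nsmul]
    congr 1; push_cast; ring
  have hvΔ : v.valuation ℚ M.Δ = WithZero.exp (-((6 * s + 3 : ℕ) : ℤ)) := by
    rw [eΔ, map_mul, map_pow, hnv, hvD, ← WithZero.exp_nsmul, ← WithZero.exp_add]
    congr 1; push_cast; ring
  have hexp_le : ∀ k : ℕ, WithZero.exp (-(k : ℤ)) ≤ (1 : WithZero (Multiplicative ℤ)) := fun k ↦ by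
    rw [← WithZero.exp_zero, WithZero.exp_le_exp]; omega
  -- integrality and minimality
  have hint : M.IsIntegralAt v :=
    M.isIntegralAt_of_valuation_le_one v (by rw [e₁, map_zero]; exact zero_le_one)
      (by rw [e₂, map_zero]; exact zero_le_one) (by rw [e₃, map_zero]; exact zero_le_one)
      (by rw [hva₄]; exact hexp_le _) (hva₆.trans (hexp_le _))
  have hmin : M.IsMinimalAt v :=
    isMinimalAt_of_lt_valuation_Δ_holds hint (by rw [hvΔ]; exact WithZero.exp_lt_exp.mpr (by omega))
  set X := M.baseChange (v.adicCompletion ℚ) with hX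
  haveI hXint : X.IsIntegral (v.adicCompletionIntegers ℚ) := hint
  haveI hXmin : X.IsMinimal (v.adicCompletionIntegers ℚ) := hmin
  haveI hXell : X.IsElliptic := by rw [hX, WeierstrassCurve.baseChange]; infer_instance
  set I := X.integralModel (v.adicCompletionIntegers ℚ) with hI
  have hva : ∀ (x : v.adicCompletionIntegers ℚ) (q : ℚ),
      algebraMap (v.adicCompletionIntegers ℚ) (v.adicCompletion ℚ) x =
        algebraMap ℚ (v.adicCompletion ℚ) q →
      Valued.v (x : v.adicCompletion ℚ) = v.valuation ℚ q := by
    intro x q h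
    rw [show (x : v.adicCompletion ℚ) = algebraMap _ (v.adicCompletion ℚ) x from rfl, h,
      WeierstrassCurve.valued_algebraMap_adicCompletion]
  have hIa₁ : Valued.v ((I.a₁ : v.adicCompletionIntegers ℚ) : v.adicCompletion ℚ) = 0 := by
    rw [hva _ _ (by rw [hI, integralModel_a₁_eq, hX, WeierstrassCurve.baseChange, map_a₁]), e₁,
      map_zero]
  have hIa₂ : Valued.v ((I.a₂ : v.adicCompletionIntegers ℚ) : v.adicCompletion ℚ) = 0 := by
    rw [hva _ _ (by rw [hI, integralModel_a₂_eq, hX, WeierstrassCurve.baseChange, map_a₂]), e₂,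
      map_zero]
  have hIa₃ : Valued.v ((I.a₃ : v.adicCompletionIntegers ℚ) : v.adicCompletion ℚ) = 0 := by
    rw [hva _ _ (by rw [hI, integralModel_a₃_eq, hX, WeierstrassCurve.baseChange, map_a₃]), e₃,
      map_zero]
  have hIa₄ : Valued.v ((I.a₄ : v.adicCompletionIntegers ℚ) : v.adicCompletion ℚ) =
      WithZero.exp (-((2 * s + 1 : ℕ) : ℤ)) := by
    rw [hva _ _ (by rw [hI, integralModel_a₄_eq, hX, WeierstrassCurve.baseChange, map_a₄]), hva₄]
  have hIa₆ : Valued.v ((I.a₆ : v.adicCompletionIntegers ℚ) : v.adicCompletion ℚ) ≤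
      WithZero.exp (-((3 * s + 2 : ℕ) : ℤ)) := by
    rw [hva _ _ (by rw [hI, integralModel_a₆_eq, hX, WeierstrassCurve.baseChange, map_a₆])]; exact hva₆
  have hIb₂ : Valued.v ((I.b₂ : v.adicCompletionIntegers ℚ) : v.adicCompletion ℚ) = 0 := by
    rw [hva _ _ (by rw [hI, integralModel_b₂_eq, hX, WeierstrassCurve.baseChange, map_b₂]), eb₂,
      map_zero]
  have hIb₈ : Valued.v ((I.b₈ : v.adicCompletionIntegers ℚ) : v.adicCompletion ℚ) =
      WithZero.exp (-((4 * s + 2 : ℕ) : ℤ)) := by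
    rw [hva _ _ (by rw [hI, integralModel_b₈_eq, hX, WeierstrassCurve.baseChange, map_b₈]), hvb₈]
  have hIΔ : Valued.v ((I.Δ : v.adicCompletionIntegers ℚ) : v.adicCompletion ℚ) =
      WithZero.exp (-((6 * s + 3 : ℕ) : ℤ)) := by
    rw [← hvΔ]
    exact hva _ _ (by rw [hI, integralModel_Δ_eq, hX, WeierstrassCurve.baseChange, map_Δ])
  -- divisibilities on the `O_v`-model
  set ϖ := uniformizer (v.adicCompletionIntegers ℚ) with hϖ
  have dvdk : ∀ {x : v.adicCompletionIntegers ℚ} (k : ℕ),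
      Valued.v (x : v.adicCompletion ℚ) ≤ WithZero.exp (-(k : ℤ)) → ϖ ^ k ∣ x := fun {x} k hx ↦
    uniformizer_pow_dvd_of_valued_le v (x := x) (n := k) hx
  have dvd0 : ∀ {x : v.adicCompletionIntegers ℚ} (k : ℕ),
      Valued.v (x : v.adicCompletion ℚ) = 0 → ϖ ^ k ∣ x := fun {x} k hx ↦
    dvdk k (by rw [hx]; exact zero_le)
  have dvd1 : ∀ {x : v.adicCompletionIntegers ℚ}, Valued.v (x : v.adicCompletion ℚ) = 0 → ϖ ∣ x :=
    fun {x} hx ↦ by have := dvd0 (x := x) 1 hx; rwa [pow_one] at this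
  have ha₄k : ∀ k : ℕ, k ≤ 2 * s + 1 → ϖ ^ k ∣ I.a₄ := fun k hk ↦
    dvdk k (by rw [hIa₄]; exact WithZero.exp_le_exp.mpr (by omega))
  have ha₆k : ∀ k : ℕ, k ≤ 3 * s + 2 → ϖ ^ k ∣ I.a₆ := fun k hk ↦
    dvdk k (hIa₆.trans (WithZero.exp_le_exp.mpr (by omega)))
  -- Tate's algorithm
  have hK : I.kodairaSymbolOfMinimal = .III ∨ I.kodairaSymbolOfMinimal = .IIIstar := by
    rcases (show s = 0 ∨ s = 1 by omega) with rfl | rfl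
    · -- `s = 0`: type `III`
      have nΔ : ϖ ∣ I.Δ := by
        have := dvdk (x := I.Δ) 1 (by rw [hIΔ]; exact WithZero.exp_le_exp.mpr (by omega))
        rwa [pow_one] at this
      have n4 : ϖ ∣ I.a₄ := by have := ha₄k 1 (by omega); rwa [pow_one] at this
      have n6 : ϖ ∣ I.a₆ := by have := ha₆k 1 (by omega); rwa [pow_one] at this
      refine Or.inl (kodairaSymbolOfMinimal_eq_III_of_step2 nΔ (dvd1 hIa₃) n4 n6 (dvd1 hIb₂)
        (ha₆k 2 (by omega)) ?_)
      intro h3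
      exact not_pow_succ_dvd_of_valued_eq'' v (n := 2) hIb₈ h3
    · -- `s = 1`: type `III*`
      refine Or.inr (kodairaSymbolOfMinimal_eq_IIIstar_of_step9 (dvd1 hIa₁) (dvd0 2 hIa₂)
        (dvd0 3 hIa₃) (ha₄k 3 (by omega)) (ha₆k 5 (by omega)) ?_)
      exact not_pow_succ_dvd_of_valued_eq'' v (n := 3) hIa₄
  -- read `kodairaSymbolAt` of `W` on the minimal model `X`
  have hrel : X = (D.map (algebraMap ℚ (v.adicCompletion ℚ))) • W.baseChange (v.adicCompletion ℚ) := by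
    rw [hX, hM, WeierstrassCurve.baseChange, WeierstrassCurve.baseChange, map_variableChange]
  rw [W.kodairaSymbolAt_eq_kodairaSymbolOfMinimal_of_isMinimal v X _ hrel X.isUnit_Δ.ne_zero, ← hI]
  exact hK

/-- **Every curve with the `j`-invariant (`≠ 0, 1728`) of a short model `E₀ : y² = x³ + Ax + B` of
type-`III` data at `ℓ` (`ℓ ∥ A`, `ℓ² ∣ B`, `ℓ³ ∥ Δ(E₀)`) has Kodaira type `III` or `III*` at the place
`v` over `ℓ`**: `W ≅ E₀^{(d)}` (*AEC* X.5.4), `d = c²n` with `n` square-free, then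
`kodairaSymbolAt_of_short_twist`. [cite: SilvermanAEC2009, X.5 Prop. 5.4 and Cor. 5.4.1] [cite: SilvermanATAEC1994, IV.9.4 and Table 4.1] -/
theorem kodairaSymbolAt_of_j_eq_short (W : WeierstrassCurve ℚ) [W.IsElliptic]
    (v : HeightOneSpectrum (𝓞 ℚ)) (A B Dz : ℤ)
    [hE : (⟨0, 0, 0, (A : ℚ), (B : ℚ)⟩ : WeierstrassCurve ℚ).IsElliptic]
    (hΔ : (⟨0, 0, 0, (A : ℚ), (B : ℚ)⟩ : WeierstrassCurve ℚ).Δ = Dz)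
    (hA1 : (natGenerator v : ℤ) ∣ A) (hA2 : ¬ (natGenerator v : ℤ) ^ 2 ∣ A)
    (hB2 : (natGenerator v : ℤ) ^ 2 ∣ B)
    (hD3 : (natGenerator v : ℤ) ^ 3 ∣ Dz) (hD4 : ¬ (natGenerator v : ℤ) ^ 4 ∣ Dz)
    (hj : W.j = (⟨0, 0, 0, (A : ℚ), (B : ℚ)⟩ : WeierstrassCurve ℚ).j) (h0 : W.j ≠ 0)
    (h1728 : W.j ≠ 1728) :
    W.kodairaSymbolAt v = .III ∨ W.kodairaSymbolAt v = .IIIstar := by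
  set E₀ : WeierstrassCurve ℚ := ⟨0, 0, 0, (A : ℚ), (B : ℚ)⟩ with hE₀
  obtain ⟨d, hd0, C, hC⟩ := exists_variableChange_eq_quadraticTwist_of_j_eq' (E := E₀) hj h0 h1728
  obtain ⟨c, n, hc, hsq, hdn⟩ := Rat.exists_sq_mul_squarefree hd0
  set T : VariableChange ℚ := ⟨(Units.mk0 c hc)⁻¹, 0, 0, 0⟩ with hT
  have hM : E₀.quadraticTwist (n : ℚ) = (T⁻¹ * C) • W := by
    rw [mul_smul, hC, hdn, quadraticTwist_sq_mul E₀ hc, ← hT, inv_smul_smul]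
  have hn2 : ¬ (natGenerator v : ℤ) ^ 2 ∣ n := fun h9 ↦ by
    have hu := hsq (natGenerator v : ℤ) (by simpa [sq] using h9)
    rw [Int.isUnit_iff] at hu
    have := (prime_natGenerator v).two_le
    omega
  exact kodairaSymbolAt_of_short_twist W v A B Dz hΔ hA1 hA2 hB2 hD3 hD4 hn2 _ hM

/-! ### §2 The X12 corner at a CM-ramified `p ≥ 5` -/

section Ramified

variable (W : WeierstrassCurve ℚ) [W.IsElliptic] (p : ℕ) [hp : Fact p.Prime]

/-- **The CM-ramified primes `p ≥ 5` of a CM curve over `ℚ`**: if `p ≥ 5` divides the CM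
discriminant `d_K` then `d_K ∈ {−7, −11, −19, −43, −67, −163}`, `p = |d_K|`, and `p ≡ 3 (mod 4)` —
the `j`-invariant is one of the seven values of the fields `ℚ(√−7)` (two orders), `ℚ(√−11)`,
`ℚ(√−19)`, `ℚ(√−43)`, `ℚ(√−67)`, `ℚ(√−163)`. [cite: SilvermanATAEC1994, App. A §3] -/
theorem eq_natAbs_cmFieldDiscrOfJ_of_cmRamified (hCM : W.HasCM) (hp5 : 5 ≤ p) (h : CMRamified W p) :
    (p : ℤ) = -cmFieldDiscrOfJ W.j ∧ p % 4 = 3 ∧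
      (W.j = -3375 ∨ W.j = 16581375 ∨ W.j = -32768 ∨ W.j = -884736 ∨ W.j = -884736000 ∨
        W.j = -147197952000 ∨ W.j = -262537412640768000) := by
  have hj : W.j ∈ cmJInvariants := (hasCM_iff_j_mem_holds W).mp hCM
  have hpp : p.Prime := hp.out
  unfold CMRamified at h
  simp only [cmJInvariants, Finset.mem_insert, Finset.mem_singleton] at hj
  -- small divisors are impossible for `p ≥ 5`
  have no3 : ¬ (p : ℤ) ∣ 3 := fun h3 ↦ by
    have h' : p ∣ 3 := by exact_mod_cast h3
    have := Nat.le_of_dvd (by norm_num) h'; omega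
  have no2 : ∀ k : ℕ, ¬ (p : ℤ) ∣ (2 : ℤ) ^ k := fun k hk ↦ by
    have h' : p ∣ 2 ^ k := by exact_mod_cast hk
    have := Nat.le_of_dvd (by norm_num) (hpp.dvd_of_dvd_pow h'); omega
  rcases hj with hj | hj | hj | hj | hj | hj | hj | hj | hj | hj | hj | hj | hj <;>
    rw [hj] at h ⊢ <;> norm_num [cmFieldDiscrOfJ] at h ⊢
  · exact no3 h
  · exact no2 2 (by norm_num; exact h)
  · have := eq_of_prime_dvd_prime (q := 7) (by norm_num) hp5 (by exact_mod_cast h); subst this; norm_num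
  · exact no2 3 (by norm_num; exact h)
  · have := eq_of_prime_dvd_prime (q := 11) (by norm_num) hp5 (by exact_mod_cast h); subst this; norm_num
  · exact no3 h
  · exact no2 2 (by norm_num; exact h)
  · have := eq_of_prime_dvd_prime (q := 19) (by norm_num) hp5 (by exact_mod_cast h); subst this; norm_num
  · exact no3 h
  · have := eq_of_prime_dvd_prime (q := 7) (by norm_num) hp5 (by exact_mod_cast h); subst this; norm_num
  · have := eq_of_prime_dvd_prime (q := 43) (by norm_num) hp5 (by exact_mod_cast h); subst this; norm_num
  · have := eq_of_prime_dvd_prime (q := 67) (by norm_num) hp5 (by exact_mod_cast h); subst this; norm_num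
  · have := eq_of_prime_dvd_prime (q := 163) (by norm_num) hp5 (by exact_mod_cast h); subst this; norm_num

/-- **O11 local types.** For `W/ℚ` in class X12 at a prime `p ≥ 5` RAMIFIED in the CM field
(`p ∣ d_K`: class O11 of HOME `CLASS-CLOSURE-PLAN.md` §3.14), at the place `v` over `p` the Kodaira
type is `III` or `III*` (semistability defect `e = 4`), `p ∈ {7, 11, 19, 43, 67, 163}`,
`p ≡ 3 (mod 4)`, hence `4 ∣ p + 1`: the local-type law `e ∣ p + 1` holds on O11 as on O10. The
curve is a quadratic twist of the short model of Gross's curve `A(p)` (Cremona `49a1, 49a2, 121b1,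
361a1, 1849a1, 4489a1, 26569a1`; `y² = x³ + Ax + B` with `p ∥ A`, `p² ∣ B`, `p³ ∥ Δ`).
[cite: SilvermanATAEC1994, IV.9.4, Table 4.1 and App. A §3] [cite: SilvermanAEC2009, X.5 Prop. 5.4]
[cite: Cremona1997, Table 1 (curves 49a1, 49a2, 121b1, 361a1, 1849a1, 4489a1, 26569a1)] -/
theorem localType_of_classX12_of_cmRamified (hX : ClassX12 W p) (hp5 : 5 ≤ p) (hram : CMRamified W p)
    (v : HeightOneSpectrum (𝓞 ℚ)) (hv : natGenerator v = p) :
    (W.kodairaSymbolAt v = .III ∨ W.kodairaSymbolAt v = .IIIstar) ∧ p % 4 = 3 ∧ 4 ∣ p + 1 ∧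
      (p = 7 ∨ p = 11 ∨ p = 19 ∨ p = 43 ∨ p = 67 ∨ p = 163) := by
  obtain ⟨hpd, hp4, hj⟩ := eq_natAbs_cmFieldDiscrOfJ_of_cmRamified W p hX.1 hp5 hram
  refine ⟨?_, hp4, by omega, ?_⟩
  swap
  · rcases hj with hj | hj | hj | hj | hj | hj | hj <;> rw [hj] at hpd <;>
      norm_num [cmFieldDiscrOfJ] at hpd <;> omega
  rcases hj with hj | hj | hj | hj | hj | hj | hj
  · -- `j = -3375`: `p = 7`, short model of `49a1`: `A = -2835, B = -71442, Δ = -746636341248 = -2¹²3¹²7³`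
    have hp7 : p = 7 := by rw [hj] at hpd; norm_num [cmFieldDiscrOfJ] at hpd; omega
    subst hp7
    haveI := isElliptic_of_discOf_ne_zero 0 0 0 (-2835) (-71442) (by decide)
    have hjE : (⟨((0 : ℤ) : ℚ), ((0 : ℤ) : ℚ), ((0 : ℤ) : ℚ), ((-2835 : ℤ) : ℚ), ((-71442 : ℤ) : ℚ)⟩ : WeierstrassCurve ℚ).j = -3375 := by
      rw [j, Units.inv_mul_eq_iff_eq_mul, coe_Δ']
      norm_num [WeierstrassCurve.c₄, WeierstrassCurve.Δ, WeierstrassCurve.b₂, WeierstrassCurve.b₄, WeierstrassCurve.b₆, WeierstrassCurve.b₈]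
    refine kodairaSymbolAt_of_j_eq_short W v (-2835) (-71442) (-746636341248)
      (by norm_num [WeierstrassCurve.Δ, WeierstrassCurve.b₂, WeierstrassCurve.b₄, WeierstrassCurve.b₆, WeierstrassCurve.b₈])
      ?_ ?_ ?_ ?_ ?_ (by push_cast at hjE ⊢; exact hj.trans hjE.symm) (by rw [hj]; norm_num) (by rw [hj]; norm_num)
    all_goals rw [hv]; norm_num
  · -- `j = 16581375`: `p = 7`, short model of `49a2`: `A = -48195, B = -4072194, Δ = 746636341248`
    have hp7 : p = 7 := by rw [hj] at hpd; norm_num [cmFieldDiscrOfJ] at hpd; omega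
    subst hp7
    haveI := isElliptic_of_discOf_ne_zero 0 0 0 (-48195) (-4072194) (by decide)
    have hjE : (⟨((0 : ℤ) : ℚ), ((0 : ℤ) : ℚ), ((0 : ℤ) : ℚ), ((-48195 : ℤ) : ℚ), ((-4072194 : ℤ) : ℚ)⟩ : WeierstrassCurve ℚ).j = 16581375 := by
      rw [j, Units.inv_mul_eq_iff_eq_mul, coe_Δ']
      norm_num [WeierstrassCurve.c₄, WeierstrassCurve.Δ, WeierstrassCurve.b₂, WeierstrassCurve.b₄, WeierstrassCurve.b₆, WeierstrassCurve.b₈]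
    refine kodairaSymbolAt_of_j_eq_short W v (-48195) (-4072194) 746636341248
      (by norm_num [WeierstrassCurve.Δ, WeierstrassCurve.b₂, WeierstrassCurve.b₄, WeierstrassCurve.b₆, WeierstrassCurve.b₈])
      ?_ ?_ ?_ ?_ ?_ (by push_cast at hjE ⊢; exact hj.trans hjE.symm) (by rw [hj]; norm_num) (by rw [hj]; norm_num)
    all_goals rw [hv]; norm_num
  · -- `j = -32768`: `p = 11`, short model of `121b1`: `A = -9504, B = 365904, Δ = -2897297289216`
    have hp11 : p = 11 := by rw [hj] at hpd; norm_num [cmFieldDiscrOfJ] at hpd; omega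
    subst hp11
    haveI := isElliptic_of_discOf_ne_zero 0 0 0 (-9504) 365904 (by decide)
    have hjE : (⟨((0 : ℤ) : ℚ), ((0 : ℤ) : ℚ), ((0 : ℤ) : ℚ), ((-9504 : ℤ) : ℚ), ((365904 : ℤ) : ℚ)⟩ : WeierstrassCurve ℚ).j = -32768 := by
      rw [j, Units.inv_mul_eq_iff_eq_mul, coe_Δ']
      norm_num [WeierstrassCurve.c₄, WeierstrassCurve.Δ, WeierstrassCurve.b₂, WeierstrassCurve.b₄, WeierstrassCurve.b₆, WeierstrassCurve.b₈]
    refine kodairaSymbolAt_of_j_eq_short W v (-9504) 365904 (-2897297289216)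
      (by norm_num [WeierstrassCurve.Δ, WeierstrassCurve.b₂, WeierstrassCurve.b₄, WeierstrassCurve.b₆, WeierstrassCurve.b₈])
      ?_ ?_ ?_ ?_ ?_ (by push_cast at hjE ⊢; exact hj.trans hjE.symm) (by rw [hj]; norm_num) (by rw [hj]; norm_num)
    all_goals rw [hv]; norm_num
  · -- `j = -884736`: `p = 19`, short model of `361a1`: `A = -49248, B = 4210704, Δ = -14930550042624`
    have hp19 : p = 19 := by rw [hj] at hpd; norm_num [cmFieldDiscrOfJ] at hpd; omega
    subst hp19
    haveI := isElliptic_of_discOf_ne_zero 0 0 0 (-49248) 4210704 (by decide)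
    have hjE : (⟨((0 : ℤ) : ℚ), ((0 : ℤ) : ℚ), ((0 : ℤ) : ℚ), ((-49248 : ℤ) : ℚ), ((4210704 : ℤ) : ℚ)⟩ : WeierstrassCurve ℚ).j = -884736 := by
      rw [j, Units.inv_mul_eq_iff_eq_mul, coe_Δ']
      norm_num [WeierstrassCurve.c₄, WeierstrassCurve.Δ, WeierstrassCurve.b₂, WeierstrassCurve.b₄, WeierstrassCurve.b₆, WeierstrassCurve.b₈]
    refine kodairaSymbolAt_of_j_eq_short W v (-49248) 4210704 (-14930550042624)
      (by norm_num [WeierstrassCurve.Δ, WeierstrassCurve.b₂, WeierstrassCurve.b₄, WeierstrassCurve.b₆, WeierstrassCurve.b₈])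
      ?_ ?_ ?_ ?_ ?_ (by push_cast at hjE ⊢; exact hj.trans hjE.symm) (by rw [hj]; norm_num) (by rw [hj]; norm_num)
    all_goals rw [hv]; norm_num
  · -- `j = -884736000`: `p = 43`, short model of `1849a1`: `A = -1114560, B = 452901456, Δ = -173069433188352`
    have hp43 : p = 43 := by rw [hj] at hpd; norm_num [cmFieldDiscrOfJ] at hpd; omega
    subst hp43
    haveI := isElliptic_of_discOf_ne_zero 0 0 0 (-1114560) 452901456 (by decide)
    have hjE : (⟨((0 : ℤ) : ℚ), ((0 : ℤ) : ℚ), ((0 : ℤ) : ℚ), ((-1114560 : ℤ) : ℚ), ((452901456 : ℤ) : ℚ)⟩ : WeierstrassCurve ℚ).j = -884736000 := by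
      rw [j, Units.inv_mul_eq_iff_eq_mul, coe_Δ']
      norm_num [WeierstrassCurve.c₄, WeierstrassCurve.Δ, WeierstrassCurve.b₂, WeierstrassCurve.b₄, WeierstrassCurve.b₆, WeierstrassCurve.b₈]
    refine kodairaSymbolAt_of_j_eq_short W v (-1114560) 452901456 (-173069433188352)
      (by norm_num [WeierstrassCurve.Δ, WeierstrassCurve.b₂, WeierstrassCurve.b₄, WeierstrassCurve.b₆, WeierstrassCurve.b₈])
      ?_ ?_ ?_ ?_ ?_ (by push_cast at hjE ⊢; exact hj.trans hjE.symm) (by rw [hj]; norm_num) (by rw [hj]; norm_num)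
    all_goals rw [hv]; norm_num
  · -- `j = -147197952000`: `p = 67`, short model of `4489a1`: `A = -9551520, B = 11362054032, Δ = -654695585722368`
    have hp67 : p = 67 := by rw [hj] at hpd; norm_num [cmFieldDiscrOfJ] at hpd; omega
    subst hp67
    haveI := isElliptic_of_discOf_ne_zero 0 0 0 (-9551520) 11362054032 (by decide)
    have hjE : (⟨((0 : ℤ) : ℚ), ((0 : ℤ) : ℚ), ((0 : ℤ) : ℚ), ((-9551520 : ℤ) : ℚ), ((11362054032 : ℤ) : ℚ)⟩ : WeierstrassCurve ℚ).j = -147197952000 := by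
      rw [j, Units.inv_mul_eq_iff_eq_mul, coe_Δ']
      norm_num [WeierstrassCurve.c₄, WeierstrassCurve.Δ, WeierstrassCurve.b₂, WeierstrassCurve.b₄, WeierstrassCurve.b₆, WeierstrassCurve.b₈]
    refine kodairaSymbolAt_of_j_eq_short W v (-9551520) 11362054032 (-654695585722368)
      (by norm_num [WeierstrassCurve.Δ, WeierstrassCurve.b₂, WeierstrassCurve.b₄, WeierstrassCurve.b₆, WeierstrassCurve.b₈])
      ?_ ?_ ?_ ?_ ?_ (by push_cast at hjE ⊢; exact hj.trans hjE.symm) (by rw [hj]; norm_num) (by rw [hj]; norm_num)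
    all_goals rw [hv]; norm_num
  · -- `j = -262537412640768000`: `p = 163`, short model of `26569a1`: `A = -2818048320, B = 57579881513616, Δ = -9427093571284992`
    have hp163 : p = 163 := by rw [hj] at hpd; norm_num [cmFieldDiscrOfJ] at hpd; omega
    subst hp163
    haveI := isElliptic_of_discOf_ne_zero 0 0 0 (-2818048320) 57579881513616 (by decide)
    have hjE : (⟨((0 : ℤ) : ℚ), ((0 : ℤ) : ℚ), ((0 : ℤ) : ℚ), ((-2818048320 : ℤ) : ℚ), ((57579881513616 : ℤ) : ℚ)⟩ : WeierstrassCurve ℚ).j = -262537412640768000 := by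
      rw [j, Units.inv_mul_eq_iff_eq_mul, coe_Δ']
      norm_num [WeierstrassCurve.c₄, WeierstrassCurve.Δ, WeierstrassCurve.b₂, WeierstrassCurve.b₄, WeierstrassCurve.b₆, WeierstrassCurve.b₈]
    refine kodairaSymbolAt_of_j_eq_short W v (-2818048320) 57579881513616 (-9427093571284992)
      (by norm_num [WeierstrassCurve.Δ, WeierstrassCurve.b₂, WeierstrassCurve.b₄, WeierstrassCurve.b₆, WeierstrassCurve.b₈])
      ?_ ?_ ?_ ?_ ?_ (by push_cast at hjE ⊢; exact hj.trans hjE.symm) (by rw [hj]; norm_num) (by rw [hj]; norm_num)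
    all_goals rw [hv]; norm_num

end Ramified

end Summit.BirchSwinnertonDyer.Rank1Residual.X12

end
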